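import Mathlib
import Summits.NavierStokesRegularity.NavierStokesRegularity.Theorems.FilamentSkeletonRssDefectColumnGateRadialField
import Summits.NavierStokesRegularity.NavierStokesRegularity.Theorems.FilamentSkeletonRssDefectColumnGateRadialBlock
import Summits.NavierStokesRegularity.NavierStokesRegularity.Theorems.FilamentSkeletonRssDefectColumnGateQuasimodeWitness

/-!
# Route `FilamentSkeletonRss` · crux `TransverseReduction1AG` (stmt-NavierStokesRegularity-27853) · line `defect_column_gate_1AG` —
# S2a-loc ON THE RADIAL SECTOR: the localised sectional waist gate holds for axisymmetric swirl perturbations of the symmetric column,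
# with constant `(1 + 13/γ)²` and NO loss in the localisation radius `R` or the circulation `Rc`

Helper file (theorems only, `--supports stmt-NavierStokesRegularity-27853 --as helper`; LEAD of 27853, lane ns-filament-21221-p1 g11).  ASSEMBLY of
`colForceVort_rad` (`Theorems/…RadialField.lean`: on `W = ∇ψ(y₀²+y₁²) × e₃` the S2a operator of the frozen waist column with sectional strain
`B = diag(−γ/2, −γ/2, 3/2+γ)` is `−(4q w″ + 4w′ + γ q w′ + γ w)(q)·e₃`, `w = −(4uψ″ + 4ψ′)`, `q = y₀² + y₁²`) with `radialBlock_apriori_deriv2`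
(`Theorems/…RadialBlock.lean`, p661788): **`waistColumnGateLoc1A_radial`** — for every `γ > 0`, every rate `α`, every circulation `Rc`, every `R > 0`
and every `ψ ∈ C⁴(ℝ)` with `ψ′ = 0` on `[R², ∞)` (so that `W` vanishes outside the sectional cylinder of radius `R`),
`secWt e₃ y² · ‖colForceVort B α γ Rc e₃ W y‖ ≤ M for all y  ⟹  secWt e₃ y² · ‖curl W y‖ ≤ (1 + 13/γ)²·M for all y`.
This is the conclusion of the registered stub S2a-loc `WaistColumnGateLoc1A` (Defs §7) on the m = 0 sector of the symmetric column, with `q = 0`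
(no `Rc^q R^q` loss at all): the crux's «two-way m = 0 waveguide» costs nothing, and the zero sectional mass that compact support forces
(`∫₀^{R²} w = −4[uψ′]₀^{R²} = 0`) is what removes the `e^{γR²/4}` kernel amplification (see the RadialBlock docstring).  The stub itself quantifies over
ALL frames, strains `B` in the box, non-radial and axially varying `W`; nothing here claims it.  HONEST FRAMING: an a-priori estimate for ONE sector
of ONE linear MODEL operator of a hypothetical blow-up route (MODEL rung, negative side); `WaistColumnGateLoc1A` and `TransverseReduction1AG` are
neither proved nor refuted; nothing here bears on Navier–Stokes regularity.
-/

set_option linter.dupNamespace false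

noncomputable section

namespace Summit.NavierStokesRegularity.NavierStokesRegularity.Theorems.DefectColumnGate

open scoped BigOperators Topology InnerProductSpace Laplacian ContDiff
open Set Function MeasureTheory intervalIntegral
open Literature.Analysis.FluidPDE
open Summit.NavierStokesRegularity.NavierStokesRegularity.Theorems.KelvinGate

/-- A continuous function vanishing on `(U, ∞)` vanishes at `U`. -/
theorem eq_zero_of_eq_zero_Ioi {g : ℝ → ℝ} (hg : Continuous g) {U : ℝ} (h : ∀ u, U < u → g u = 0) : g U = 0 := by
  have hS : IsClosed {u : ℝ | g u = 0} := isClosed_eq hg continuous_const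
  have hsub : Ioi U ⊆ {u : ℝ | g u = 0} := fun u hu => h u hu
  have hcl : closure (Ioi U) ⊆ {u : ℝ | g u = 0} := hS.closure_subset_iff.mpr hsub
  have hU : U ∈ closure (Ioi U) := by rw [closure_Ioi]; exact self_mem_Ici
  exact hcl hU

/-- If `ψ′ = 0` on `[U, ∞)` and `ψ ∈ C²` then `ψ″ = 0` on `[U, ∞)`. -/
theorem deriv_deriv_eq_zero_of_deriv_eq_zero {ψ : ℝ → ℝ} (hψ : ContDiff ℝ 2 ψ) {U : ℝ} (h : ∀ u, U ≤ u → deriv ψ u = 0) :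
    ∀ u, U ≤ u → deriv (deriv ψ) u = 0 := by
  have hopen : ∀ u, U < u → deriv (deriv ψ) u = 0 := by
    intro u hu
    have hev : deriv ψ =ᶠ[𝓝 u] fun _ => (0:ℝ) := by
      filter_upwards [Ioi_mem_nhds hu] with s hs
      exact h s (le_of_lt hs)
    rw [hev.deriv_eq, deriv_const]
  have hcont : Continuous (deriv (deriv ψ)) := by
    have h2 : ContDiff ℝ 0 (deriv (deriv ψ)) := by
      have := hψ.iterate_deriv' 0 2; simpa using this
    exact h2.continuous
  intro u hu
  rcases eq_or_lt_of_le hu with heq | hlt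
  · subst heq; exact eq_zero_of_eq_zero_Ioi hcont hopen
  · exact hopen u hlt

/-- **S2a-loc on the radial sector of the symmetric column, no loss.**  See the module docstring. -/
theorem waistColumnGateLoc1A_radial {γ α Rc R M : ℝ} (hγ : 0 < γ) (hR : 0 < R)
    {B : EuclideanSpace ℝ (Fin 3) →L[ℝ] EuclideanSpace ℝ (Fin 3)}
    (hB0 : B (EuclideanSpace.single 0 1) = (-(γ / 2)) • EuclideanSpace.single 0 1)
    (hB1 : B (EuclideanSpace.single 1 1) = (-(γ / 2)) • EuclideanSpace.single 1 1)
    (hB2 : B (EuclideanSpace.single 2 1) = (3 / 2 + γ) • EuclideanSpace.single 2 1)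
    {ψ : ℝ → ℝ} (hψ : ContDiff ℝ 4 ψ) (hsupp : ∀ u, R ^ 2 ≤ u → deriv ψ u = 0)
    (hforce : ∀ y, secWt (EuclideanSpace.single 2 1) y ^ 2 *
        ‖colForceVort B α γ Rc (EuclideanSpace.single 2 1)
            (fun z => cross (gradient (fun y : EuclideanSpace ℝ (Fin 3) => ψ (y 0 ^ 2 + y 1 ^ 2)) z) (EuclideanSpace.single 2 1)) y‖ ≤ M) :
    ∀ y, secWt (EuclideanSpace.single 2 1) y ^ 2 *
        ‖curl (fun z => cross (gradient (fun y : EuclideanSpace ℝ (Fin 3) => ψ (y 0 ^ 2 + y 1 ^ 2)) z) (EuclideanSpace.single 2 1)) y‖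
      ≤ (1 + 13 / γ) ^ 2 * M := by
  -- the radial vorticity profile `w` and its derivatives
  set w : ℝ → ℝ := fun u => -(4 * u * deriv (deriv ψ) u + 4 * deriv ψ u) with hwdef
  have hw : ∀ u, w u = -(4 * u * deriv (deriv ψ) u + 4 * deriv ψ u) := fun u => rfl
  have hψ2 : ContDiff ℝ 2 ψ := hψ.of_le (by norm_num)
  have hψ1 : Differentiable ℝ ψ := hψ.differentiable (by norm_num)
  have hd1 : ContDiff ℝ 3 (deriv ψ) := by
    have := hψ.iterate_deriv' 3 1; simpa using this
  have hd2 : ContDiff ℝ 2 (deriv (deriv ψ)) := by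
    have := hψ.iterate_deriv' 2 2; simpa using this
  have hd1d : Differentiable ℝ (deriv ψ) := hd1.differentiable (by norm_num)
  have hwC : ContDiff ℝ 2 w :=
    (((contDiff_const.mul contDiff_id).mul hd2).add (contDiff_const.mul (hd1.of_le (by norm_num)))).neg
  have hwd : Differentiable ℝ w := hwC.differentiable (by norm_num)
  have hdwC : ContDiff ℝ 1 (deriv w) := by
    have := hwC.iterate_deriv' 1 1; simpa using this
  have hdwd : Differentiable ℝ (deriv w) := hdwC.differentiable (by norm_num)
  -- support: `w = 0` on `[R², ∞)`
  have hψ'' : ∀ u, R ^ 2 ≤ u → deriv (deriv ψ) u = 0 := deriv_deriv_eq_zero_of_deriv_eq_zero hψ2 hsupp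
  have hwsupp : ∀ u, R ^ 2 ≤ u → w u = 0 := fun u hu => by
    rw [hw, hsupp u hu, hψ'' u hu]; ring
  -- zero mass: `∫₀^{R²} w = −4[uψ′]₀^{R²} = 0`
  have hmass : ∫ u in (0:ℝ)..R ^ 2, w u = 0 := by
    have hF : ∀ x ∈ uIcc (0:ℝ) (R ^ 2), HasDerivAt (fun u : ℝ => -(4 * u * deriv ψ u)) (w x) x := by
      intro x _
      have h := (((hasDerivAt_id' x).const_mul (4:ℝ)).mul (hd1d x).hasDerivAt).neg
      refine h.congr_deriv ?_
      rw [hw]; ring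
    rw [integral_eq_sub_of_hasDerivAt hF (hwC.continuous.intervalIntegrable _ _), hsupp (R ^ 2) le_rfl]
    ring
  -- the datum bound in the `u` variable, read off at the point `√u · e₀`
  have hf : ∀ u, 0 < u → (1 + u) ^ 2 * |4 * u * deriv (deriv w) u + 4 * deriv w u + γ * u * deriv w u + γ * w u| ≤ M := by
    intro u hu
    set y : EuclideanSpace ℝ (Fin 3) := (Real.sqrt u) • EuclideanSpace.single 0 1 with hy
    have hy0 : y 0 = Real.sqrt u := by simp [hy]
    have hy1 : y 1 = 0 := by simp [hy]
    have hq : y 0 ^ 2 + y 1 ^ 2 = u := by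
      rw [hy0, hy1, Real.sq_sqrt hu.le]; ring
    have h := hforce y
    rw [colForceVort_rad hψ hB0 hB1 hB2 w hw y, secWt_e3, add_assoc, hq, norm_smul, Real.norm_eq_abs] at h
    have he : ‖(EuclideanSpace.single (2 : Fin 3) (1 : ℝ))‖ = 1 := by
      rw [EuclideanSpace.norm_eq]; simp
    rw [he, mul_one, abs_neg] at h
    exact h
  -- the radial block
  have hblock := radialBlock_apriori_deriv2 (U := R ^ 2) hγ (by positivity) hwC.continuous.continuousOn hdwC.continuous.continuousOn
    (fun u _ => (hwd u).hasDerivAt) (fun u _ => (hdwd u).hasDerivAt) hf hwsupp hmass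
  -- read the conclusion back on `ℝ³`
  intro y
  have hΨ2 : ContDiff ℝ 2 (fun y : EuclideanSpace ℝ (Fin 3) => ψ (y 0 ^ 2 + y 1 ^ 2)) := contDiff_rad hψ2
  have hax : ∀ z, fderiv ℝ (fun y : EuclideanSpace ℝ (Fin 3) => ψ (y 0 ^ 2 + y 1 ^ 2)) z (EuclideanSpace.single 2 1) = 0 :=
    fderiv_rad_axis hψ1
  have hcurl : curl (fun z => cross (gradient (fun y : EuclideanSpace ℝ (Fin 3) => ψ (y 0 ^ 2 + y 1 ^ 2)) z) (EuclideanSpace.single 2 1)) y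
      = w (y 0 ^ 2 + y 1 ^ 2) • EuclideanSpace.single 2 1 := by
    rw [curl_streamField hΨ2 hax y, laplacian_rad hψ2 y, hw]
  have he : ‖(EuclideanSpace.single (2 : Fin 3) (1 : ℝ))‖ = 1 := by
    rw [EuclideanSpace.norm_eq]; simp
  have hq0 : 0 ≤ y 0 ^ 2 + y 1 ^ 2 := by positivity
  rw [hcurl, norm_smul, Real.norm_eq_abs, he, mul_one, secWt_e3, add_assoc]
  exact hblock _ hq0

end Summit.NavierStokesRegularity.NavierStokesRegularity.Theorems.DefectColumnGate

end
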